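import Literature.AnabelianGeometry.SemiGraphs.TemperedBranchDouble
import Literature.AnabelianGeometry.SemiGraphs.WitnessIwahoriBundle
import HarnessLib

/-!
# The DOUBLE of the estranged Iwahori loop along its torus branch: a segment satisfying the hypotheses
# of [SemiAnbd] Cor. 3.9 (witness, source of the "fold")

Witness file of the abc-iut cell (layer L3, F wave seat abc-iut-f-175; the source object of the "fold"
of finding t2g2-F1 / ruling χ2 on the LITERAL reading of [SemiAnbd] Def. 3.8).  Source of the
hypotheses: S. Mochizuki, *Semi-graphs of anabelioids*, Publ. RIMS **42** (2006), Def. 2.1 p. 22, Def.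
2.3 pp. 24–25, Def. 2.4 pp. 25–26, Cor. 3.9 p. 42; [IUTchI] Rmk. 2.5.3 (i) (T2) (Galois-countability)
[cite: MochizukiSemiAnbd2006, Cor 3.9 p.42].

THE OBJECT `doubleLoop p` (universe `0`): the double (`ProfiniteSemiGraph.double`,
`TemperedBranchDouble.lean`) of abc-iut-w5-d236's estranged loop `loopGraph p` (`WitnessIwahoriLoop`:
vertex group `P = ℤ_p ⋊ (1 + pℤ_p)`, edge group `U = 1 + pℤ_p`, branches the torus `T₀` and the twisted
complement `T₁`) ALONG ITS TORUS BRANCH: the segment `v₀ —— v₁` with `Π_{v₀} = Π_{v₁} = P`, `Π_e = U`,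
both branch maps the torus `b_0 : U → T₀ ⊂ P`.

KERNEL-CHECKED: `doubleLoop_cor39Hypotheses : Cor39Hypotheses (doubleLoop p)` — every clause of the
hypotheses of Prop. 3.6 / Thm. 3.7 / Cor. 3.9: the combinatorial ones and injective type / slimness /
aloofness / estrangement / elevation by the generic transfer lemmas of `TemperedBranchDouble.lean` from
abc-iut-w5-d236's loop; quasi-coherence and Galois-countability by the level-`n` approximators of
`WitnessIwahoriApprox` restricted to the double (`Approximator.double`).  Nothing here concerns the disputed
corpus; no side is taken on [IUTchIII] Cor. 3.12.
-/

noncomputable section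

namespace Literature.AnabelianGeometry.SemiGraphs

open Literature.AlgebraicGeometry.Frobenioids (IsSlimGroup)

namespace IwahoriWitness

open ProfiniteSemiGraph

variable (p : ℕ) [Fact p.Prime]

/-! ## 1. The object -/

/-- The TORUS branch `(0, false)` of the loop `H_1` (coefficient `0`: `U ↦ T₀ = {(0, s)}`).
[cite: MochizukiSemiAnbd2006, §1 p.16] -/
def torusBranch : (SemiGraph.bouquet.{0} 1).Branch := ⟨(0, false)⟩

/-- The torus branch has coefficient `0`. [cite: MochizukiSemiAnbd2006, Def 2.1 p.22] -/
@[simp] theorem coeff_torusBranch : coeff p torusBranch = 0 := by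
  simp [coeff, torusBranch]

/-- The torus branch abuts to the vertex of the loop. [cite: MochizukiSemiAnbd2006, §1 p.16] -/
theorem torusBranch_abuts : (loopGraph p).graph.abuts torusBranch = some PUnit.unit := rfl

/-- **The witness `𝒟₁ := doubleLoop p`**: the double of the estranged loop `𝒢₁ = loopGraph p` along its
torus branch — the segment `v₀ —— v₁` with `Π_{v_i} = P`, `Π_e = U`, both branch maps the torus.
[cite: MochizukiSemiAnbd2006, Def 2.1 p.22] -/
abbrev doubleLoop : ProfiniteSemiGraph.{0} := (loopGraph p).double (torusBranch_abuts p)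

/-- The branch maps of `𝒟₁` are the torus `b_0`. [cite: MochizukiSemiAnbd2006, Def 2.1 p.22] -/
theorem doubleLoop_brHom (β : (doubleLoop p).graph.Branch) (v : (doubleLoop p).graph.Vertex)
    (h : (doubleLoop p).graph.abuts β = some v) : (doubleLoop p).brHom β v h = Iw.bHom 0 := by
  rw [double_brHom, loopGraph_brHom, coeff_torusBranch]

/-- The branch subgroups of `𝒟₁` are the torus `T₀ = b_0(U)` (`coeff torusBranch = 0`).
[cite: MochizukiSemiAnbd2006, §2 p.23] -/
theorem doubleLoop_branchSubgroup (β : (doubleLoop p).graph.Branch) (v : (doubleLoop p).graph.Vertex)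
    (h : (doubleLoop p).graph.abuts β = some v) :
    (doubleLoop p).branchSubgroup β v h = (Iw.bHom (coeff p torusBranch)).toMonoidHom.range := rfl

/-! ## 2. The elementary clauses (transferred from the loop) -/

/-- `𝒟₁` is a graph. [cite: MochizukiSemiAnbd2006, §1 p.11] -/
theorem doubleLoop_isGraph : (doubleLoop p).IsGraph := double_isGraph _ _

/-- `𝒟₁` has a vertex. [cite: MochizukiSemiAnbd2006, Thm 3.7 p.40] -/
theorem doubleLoop_hasVertex : (doubleLoop p).HasVertex := double_hasVertex _ _

/-- `𝒟₁` is countable. [cite: MochizukiSemiAnbd2006, §1 p.11] -/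
theorem doubleLoop_isCountable : (doubleLoop p).IsCountable := double_isCountable _ _

/-- `𝒟₁` is connected. [cite: MochizukiSemiAnbd2006, §1 p.11] -/
theorem doubleLoop_isConnected : (doubleLoop p).IsConnected := double_isConnected _ _

/-- `𝒟₁` is of injective type (the torus map is injective). [cite: MochizukiSemiAnbd2006, Def 2.1 p.22] -/
theorem doubleLoop_isOfInjectiveType : (doubleLoop p).IsOfInjectiveType :=
  double_isOfInjectiveType _ _ (loopGraph_isOfInjectiveType p torusBranch PUnit.unit (torusBranch_abuts p))

/-- `𝒟₁` is verticially slim (`P` is slim). [cite: MochizukiSemiAnbd2006, Def 2.4(ii) p.25] -/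
theorem doubleLoop_isVerticiallySlim : (doubleLoop p).IsVerticiallySlim :=
  double_isVerticiallySlim _ _ (isSlimGroup_Iw p)

/-- `𝒟₁` is totally aloof (the torus is malnormal of infinite index in `P`).
[cite: MochizukiSemiAnbd2006, Def 2.4(iv) p.26] -/
theorem doubleLoop_isTotallyAloof : (doubleLoop p).IsTotallyAloof :=
  double_isTotallyAloof _ _ (loopGraph_isTotallyAloof p ⟨0⟩)

/-- `𝒟₁` is totally estranged. [cite: MochizukiSemiAnbd2006, Def 2.4(iv) p.26] -/
theorem doubleLoop_isTotallyEstranged : (doubleLoop p).IsTotallyEstranged :=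
  double_isTotallyEstranged _ _ (loopGraph_isTotallyEstranged p ⟨0⟩)

/-- `𝒟₁` is totally elevated (the translations of `P_M` meet no conjugate of the torus image).
[cite: MochizukiSemiAnbd2006, Def 2.4(i) p.25] -/
theorem doubleLoop_isTotallyElevated : (doubleLoop p).IsTotallyElevated :=
  double_isTotallyElevated _ _ (loopGraph_isTotallyElevated p PUnit.unit)

/-! ## 3. The approximator clauses: quasi-coherence and Galois-countability -/

/-- The level-`n` approximator of `𝒟₁`: that of the loop restricted to the double.
[cite: MochizukiSemiAnbd2006, Def 2.3(i) p.24] -/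
def approxD (n : ℕ) : (doubleLoop p).Approximator := (approx p n).double (torusBranch_abuts p)

/-- **`𝒟₁` is quasi-coherent** (Def. 2.3 (iii)): given finite coverings of the three constituents, the
level-`n` approximator for `n` large splits all of them. [cite: MochizukiSemiAnbd2006, Def 2.3(iii) p.25] -/
theorem doubleLoop_isQuasiCoherent : (doubleLoop p).IsQuasiCoherent := by
  intro M HV HE hV hE
  haveI : ∀ v, Finite (HV v).obj.V := fun v => (hV v).2
  haveI : ∀ e, Finite (HE e).obj.V := fun e => (hE e).2
  obtain ⟨n₀, hn₀⟩ := exists_level_acts_trivially_V p (HV ⟨false⟩)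
  obtain ⟨n₁, hn₁⟩ := exists_level_acts_trivially_V p (HV ⟨true⟩)
  obtain ⟨n₂, hn₂⟩ := exists_level_acts_trivially_E p (HE PUnit.unit)
  refine ⟨approxD p (max (max n₀ n₁) n₂), ?_, ?_⟩
  · rintro ⟨_ | _⟩ g hg x
    · exact hn₀ g (Iw.toMod_eq_one_mono ((le_max_left _ _).trans (le_max_left _ _)) g hg) x
    · exact hn₁ g (Iw.toMod_eq_one_mono ((le_max_right _ _).trans (le_max_left _ _)) g hg) x
  · rintro ⟨⟩ g hg x
    exact hn₂ g (IwU.toMod_eq_one_mono (le_max_right _ _) g hg) x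

/-- The trivialising covering of the level-`n` approximator of `𝒟₁`: a finite object of `B^cov(𝒟₁)`
with nonempty fibres. [cite: MochizukiSemiAnbd2006, Prop 2.5 p.27] -/
def levelCovD (n : ℕ) : CovObj (doubleLoop p) :=
  (approxD p n).trivCov (M := Nat.card (IwMod p n)) Nat.card_pos fun _ => dvd_rfl

/-- A point of a vertex constituent of `levelCovD n` fixed by `g` forces `g` into the level-`n` kernel.
[cite: MochizukiSemiAnbd2006, Prop 2.5 p.27] -/
theorem toMod_eq_one_of_fix_VD (n : ℕ) (v : (doubleLoop p).graph.Vertex)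
    (x : ((levelCovD p n).SV v).obj.V) (g : Iw p) (h : ((levelCovD p n).SV v).obj.ρ g x = x) :
    Iw.toMod n g = 1 := by
  have h' : ((approxD p n).objV (Nat.card (IwMod p n)) v).obj.ρ g x = x := h
  rw [Approximator.objV_ρ] at h'
  exact mul_eq_right.1 (Prod.ext_iff.1 h').1

/-- Same over the edge. [cite: MochizukiSemiAnbd2006, Prop 2.5 p.27] -/
theorem toMod_eq_one_of_fix_ED (n : ℕ) (e : (doubleLoop p).graph.Edge)
    (x : ((levelCovD p n).SE e).obj.V) (g : IwU p) (h : ((levelCovD p n).SE e).obj.ρ g x = x) :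
    IwU.toMod n g = 1 := by
  have h' : ((approxD p n).objE (Nat.card (IwMod p n)) e).obj.ρ g x = x := h
  rw [Approximator.objE_ρ] at h'
  exact mul_eq_right.1 (Prod.ext_iff.1 h').1

/-- **`𝒟₁` is Galois-countable** ([IUTchI] Rmk. 2.5.3 (i) (T2)): the trivialising coverings of the
level approximators split every finite covering. [cite: Mochizuki2012, IUTchI Rmk 2.5.3 (i) (T2), p. 52] -/
theorem doubleLoop_isGaloisCountable : (doubleLoop p).IsGaloisCountable := by
  refine ⟨doubleLoop_isCountable p, levelCovD p, fun n => ⟨?_, ?_⟩, ?_⟩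
  · exact (approxD p n).trivCov_isFinite _ _
  · exact (approxD p n).trivCov_hasNonemptyFibres _ _
  · intro H hH
    haveI : ∀ v, Finite (H.SV v).obj.V := hH.finite_V
    haveI : ∀ e, Finite (H.SE e).obj.V := hH.finite_E
    obtain ⟨n₀, h₀⟩ := exists_level_acts_trivially_V p (H.SV ⟨false⟩)
    obtain ⟨n₁, h₁⟩ := exists_level_acts_trivially_V p (H.SV ⟨true⟩)
    obtain ⟨n₂, h₂⟩ := exists_level_acts_trivially_E p (H.SE PUnit.unit)
    refine ⟨max (max n₀ n₁) n₂, ?_, ?_⟩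
    · rintro ⟨_ | _⟩ x g hgx s
      · exact h₀ g (Iw.toMod_eq_one_mono ((le_max_left _ _).trans (le_max_left _ _)) g
          (toMod_eq_one_of_fix_VD p _ _ x g hgx)) s
      · exact h₁ g (Iw.toMod_eq_one_mono ((le_max_right _ _).trans (le_max_left _ _)) g
          (toMod_eq_one_of_fix_VD p _ _ x g hgx)) s
    · rintro ⟨⟩ x g hgx s
      exact h₂ g (IwU.toMod_eq_one_mono (le_max_right _ _) g (toMod_eq_one_of_fix_ED p _ _ x g hgx)) s

/-! ## 4. The bundles -/

/-- **`𝒟₁` satisfies the hypotheses of Prop. 3.6.** [cite: MochizukiSemiAnbd2006, Prop 3.6 p.38] -/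
theorem doubleLoop_prop36Hypotheses : (doubleLoop p).Prop36Hypotheses where
  isConnected := doubleLoop_isConnected p
  isCountable := doubleLoop_isCountable p
  isGaloisCountable := doubleLoop_isGaloisCountable p
  hasVertex := doubleLoop_hasVertex p
  isOfInjectiveType := doubleLoop_isOfInjectiveType p
  isQuasiCoherent := doubleLoop_isQuasiCoherent p
  isTotallyElevated := doubleLoop_isTotallyElevated p
  isTotallyAloof := doubleLoop_isTotallyAloof p
  isVerticiallySlim := doubleLoop_isVerticiallySlim p

/-- **`𝒟₁` satisfies the hypotheses of Thm. 3.7.** [cite: MochizukiSemiAnbd2006, Thm 3.7 p.40] -/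
theorem doubleLoop_thm37Hypotheses : (doubleLoop p).Thm37Hypotheses where
  toProp36Hypotheses := doubleLoop_prop36Hypotheses p
  isTotallyEstranged := doubleLoop_isTotallyEstranged p

/-- **`𝒟₁` satisfies the hypotheses of Cor. 3.9**: a connected, countable, quasi-coherent, totally
elevated, totally estranged, verticially slim GRAPH of anabelioids with TWO vertices joined by one edge.
[cite: MochizukiSemiAnbd2006, Cor 3.9 p.42] -/
theorem doubleLoop_cor39Hypotheses : Cor39Hypotheses (doubleLoop p) where
  toProp36Hypotheses := doubleLoop_prop36Hypotheses p
  isTotallyEstranged := doubleLoop_isTotallyEstranged p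
  isGraph := doubleLoop_isGraph p

/-- Non-vacuity with TWO DISTINCT vertices joined by an edge: a segment satisfying all three bundles
(complementing abc-iut-w5-d236's one-vertex `exists_cor39Hypotheses_with_edge`).
[cite: MochizukiSemiAnbd2006, Cor 3.9 p.42] -/
theorem exists_cor39Hypotheses_segment :
    ∃ 𝒢 : ProfiniteSemiGraph.{0}, 𝒢.graph = SemiGraph.segment ∧ 𝒢.Prop36Hypotheses ∧ 𝒢.Thm37Hypotheses ∧
      Cor39Hypotheses 𝒢 :=
  ⟨doubleLoop 2, rfl, doubleLoop_prop36Hypotheses 2, doubleLoop_thm37Hypotheses 2, doubleLoop_cor39Hypotheses 2⟩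

end IwahoriWitness

end Literature.AnabelianGeometry.SemiGraphs

end
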